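import Literature.NumberTheory.Rogawski1990.ArchCentralLimitCornerValueInversion   -- ★ p844106 (this seat): FILE A′ `cornerValue_max_of_min`, FILE B `…of_wallValues[_min]`
import Literature.NumberTheory.Rogawski1990.ArchCentralLimitCompactWallOrbital      -- ★ p843448 (this seat): (A4)-I `lambda8Angle_cornerExtension_eq_of_orbital_compactWallGerms`
import Literature.NumberTheory.Automorphic.ArchLocalDiagonalFrameU21               -- ★ p843380∕p843389 (A-p18): the frame `G_w ≃ₜ* U(2,1)` and `integral_comp_conj_eq_integral_map_mkU21`
import Literature.Geometry.ComplexHyperbolic.UnitBallOrbitalKAverage               -- ★ p843997 (F0P3a-p05): the `K`-average `Θ^K` and `m_K•Φ_Θ = Φ_{Θ^K}`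
import Mathlib.Analysis.Calculus.IteratedDeriv.Lemmas
import HarnessLib

/-!
# N1 ASSEMBLY, FILE (o4) — THE D-CHAMBER WALL VALUE ON `G_w` FROM THE BALL-MODEL VALUE FOR `K`-INVARIANT TEST FUNCTIONS («hD ⟸ hD_K») (Rogawski 1990 §8.4 pp. 126–127, Prop. 8.4.1(b);
# Harish-Chandra's descent to `U(2,1)` and averaging over `K = U(2) × U(1)`)

Topic `NumberTheory/Rogawski1990`; namespace `Literature.NumberTheory.Rogawski1990`.  THEOREMS ONLY (no `def`, no instance, no notation, no axiom, no named fact, no `sorry`).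
Cell `pub/hodgecm-mathlib`, ENGINE T1 (crux H413 = `stmt-HodgeConjecture-24833`); ROAD A toward N1 = `stub_L21` ∕ `stub_ArchCentralLimitU21`; ROAD A owner F0P3a-p05 (g14) WORD R-14.4 (2)
(«(o4) is p02's»), MEMO R-14.5 `MEMO-L21-ClosingEdition`, LEAD T9-30.  HONEST LABEL: HC_CM is proved only modulo the printed citations until rung 0 closes; this file is bookkeeping
around the printed-hard letter N1 (★ p842205 `ArchCentralLimitFormulaRankTwo`) and pays nothing by itself.

WHAT.  ★ FILE B∕A′ reduce N1 (on the sign patterns with a compact pair) to (A6) corner regularity, the S-chamber third jets, and ONE value hypothesis `hDmin`: for every Haar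
measure `ν` on `G_w = archLocal L 3 (diag α) w` ONE constant `c = c(ν) > 0` such that for EVERY smooth compactly supported `Θ`, every centre `ζ` and every `θ₂`-MINIMAL chamber
`C_σ` (`σ 0 = 2`), every `C³` corner extension `H` of `F_Θ∘chart_ζ` on `C_σ` has `Λ₈^∠[H](0) = −c·i·Θ(ζ•1)`.  The chart engine (F0P3a-p05∕p06∕A-p14, W1–W6) computes that
value in the BALL MODEL `U(2,1) = U(J)`, `J = diag(1,1,−1)` and — by design (★ `UnitBallOrbitalKAverage`) — only for test functions invariant under conjugation by the maximal compact
`K`.  THIS FILE is the transfer: **`cornerValue_min_of_ball`** — at a place with `re σ_w(α₀), re σ_w(α₁) > 0 > re σ_w(α₂)`, the ball-model statement `hBall` (for every Haar `μ` on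
`U(2,1)` one `c(μ) > 0` such that every smooth, compactly supported, `K`-conjugation-invariant `Θ′` and every `ζ` admit (A4)-I wall germs `ψ, χ` — `C²` on `[0, δ]`, equal on
`(0, δ)` to `(2 − 2cos 3t)·Φ_{Θ′}(ζ·w_t)` and `(2 − 2cos 3t)²·∂_s²|₀ Φ_{Θ′}(ζ·w_t·e^{isN})`, `Φ_{Θ′}` the `U(2,1)` torus orbital integral — with
`−(2i∕3)ψ″(0⁺) − (i∕2)ψ(0) + (i∕12)χ″(0⁺) = −c·i·Θ′(ζ•1)`) implies `hDmin`.

HOW (all ★): (1) ★ `exists_continuousMulEquiv_archLocal_U21_torus` (A-p18) gives a diagonal frame `T` and `e : G_w ≃ₜ* U(2,1)`, `e(g) = T⁻¹gT`, identity on the torus;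
`μ := ν.map e` is Haar.  (2) `Θ_T := Θ∘Ad(T)` is smooth with compact support on `U(2,1)` and ★ `integral_comp_conj_eq_integral_map_mkU21` says `Φ^{G_w}_Θ(z) = Φ^{U(2,1)}_{Θ_T}(z)`.
(3) `Θ′ := (Θ_T)^K`, the `K`-average (★ `contDiff_kAverage`, `hasCompactSupport_kAverage_comp_mat`, `kAverage_conj_of_unitary_comm_J`: smooth, compactly supported, `K`-invariant;
★ `kAverage_smul_one`: `Θ′(ζ•1) = m_K·Θ(ζ•1)`), and ★ `smul_integral_comp_conj_eq_integral_kAverage_comp_conj`: `m_K·Φ_{Θ_T}(z) = Φ_{Θ′}(z)` at every torus point off the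
noncompact walls (where the orbit map is proper, ★ `hasCompactSupport_comp_conj_circleDiagonal_of_blocks`).  (4) Hence `ψ₁ := m_K⁻¹ψ`, `χ₁ := m_K⁻¹χ` are (A4)-I wall germs for
`Φ^{G_w}_Θ` (the normal-ray points `ζ·w_t·e^{isN}` are off the noncompact walls for `|s|` small, so `∂_s²|₀` sees the identity), and ★ (A4)-I
`lambda8Angle_cornerExtension_eq_of_orbital_compactWallGerms` on the `θ₂`-minimal chamber (★ `wallPoint_mem_closure_chamber_pos`) gives
`Λ₈^∠[H](0) = m_K⁻¹·(−(2i∕3)ψ″ − (i∕2)ψ(0) + (i∕12)χ″) = m_K⁻¹·(−c·i)·m_K·Θ(ζ•1) = −c·i·Θ(ζ•1)` — the SAME `c = c(ν.map e)` for all `Θ, ζ, σ, H`.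
USE (owner MEMO R-14.5, closer ED.4): `hDmin := cornerValue_min_of_ball h0 h1 h2 (W6 L α w …)` feeds ★ `ArchCentralLimitFormulaRankTwo.of_cornerRegularity_of_wallValues_min`.
-/

open Filter Topology Set MeasureTheory Measure NumberField NumberField.InfinitePlace Matrix MulAction
open Literature.NumberTheory.Automorphic Literature.NumberTheory.Automorphic.UnitaryGroup
open Literature.Geometry.ComplexHyperbolic Literature.Geometry.ComplexHyperbolic.BallModel
open scoped Matrix MatrixGroups Matrix.Norms.Operator ContDiff

namespace Literature.NumberTheory.Rogawski1990

variable (L : Type) [Field L] (α : Fin 3 → L) (w : {w : InfinitePlace L // IsComplex w})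

noncomputable section

/-! ## §1. Small facts: the `θ₂`-minimal chambers, the normal ray off the noncompact walls, nested one-sided jets -/

/-- `σ 0 = 2` forces `(σ 1, σ 2) ∈ {(0,1), (1,0)}`. [folklore] -/
private theorem perm_fin_three_of_apply_zero_eq_two (σ : Equiv.Perm (Fin 3)) (h : σ 0 = 2) : (σ 1 = 0 ∧ σ 2 = 1) ∨ (σ 1 = 1 ∧ σ 2 = 0) := by
  revert σ
  decide

/-- On the normal ray through the `θ₂`-minimal wall point `ζ·(e^{it}, e^{it}, e^{−2it})`, `0 < t ≤ 2`, the points with `|s| < min (3t∕2) (1∕4)` are off the noncompact walls. [folklore] -/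
private theorem normalRay_off_noncompact_walls (ζ : Circle) {t s : ℝ} (ht : 0 < t) (ht2 : t ≤ 2) (hs : |s| < min (3 * t / 2) (1 / 4)) :
    (fun j : Fin 3 => (fun i : Fin 3 => ζ * Circle.exp ((t • (![1, 1, -2] : Fin 3 → ℝ)) i)) j * Circle.exp (s * (![1, -1, 0] : Fin 3 → ℝ) j)) 0 ≠ (fun j : Fin 3 => (fun i : Fin 3 => ζ * Circle.exp ((t • (![1, 1, -2] : Fin 3 → ℝ)) i)) j * Circle.exp (s * (![1, -1, 0] : Fin 3 → ℝ) j)) 2 ∧ (fun j : Fin 3 => (fun i : Fin 3 => ζ * Circle.exp ((t • (![1, 1, -2] : Fin 3 → ℝ)) i)) j * Circle.exp (s * (![1, -1, 0] : Fin 3 → ℝ) j)) 1 ≠ (fun j : Fin 3 => (fun i : Fin 3 => ζ * Circle.exp ((t • (![1, 1, -2] : Fin 3 → ℝ)) i)) j * Circle.exp (s * (![1, -1, 0] : Fin 3 → ℝ) j)) 2 := by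
  have hπ : (3.14 : ℝ) < Real.pi := by linarith [Real.pi_gt_d2]
  have hs1 : |s| < 3 * t / 2 := lt_of_lt_of_le hs (min_le_left _ _)
  have hs2 : |s| < 1 / 4 := lt_of_lt_of_le hs (min_le_right _ _)
  have habs := abs_lt.mp hs1
  have habs' := abs_lt.mp hs2
  have key : ∀ u : ℝ, |u| < 1 / 4 → |u| < 3 * t / 2 → ζ * Circle.exp t * Circle.exp u ≠ ζ * Circle.exp (-(t * 2)) * Circle.exp 0 := by
    intro u hu hu'
    have hu1 := abs_lt.mp hu
    have hu2 := abs_lt.mp hu'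
    rw [Circle.exp_zero, mul_one, mul_assoc, ← Circle.exp_add, Ne, mul_right_inj]
    refine circleExp_ne_of_abs_sub_lt_two_pi (by intro h; linarith) ?_
    rw [abs_lt]; constructor <;> nlinarith
  simp only [Pi.smul_apply, smul_eq_mul, Matrix.cons_val_zero, Matrix.cons_val_one, Matrix.cons_val_two, Matrix.tail_cons, Matrix.head_cons,
    mul_one, mul_neg, mul_zero]
  refine ⟨key s hs2 hs1, ?_⟩
  have := key (-s) (by rwa [abs_neg]) (by rwa [abs_neg])
  simpa only [mul_neg, mul_one] using this

/-- `[0, δ′] =ᶠ[𝓝 0] [0, δ]` for `0 < δ′ ≤ δ`. [folklore] -/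
private theorem Icc_eventuallyEq_Icc_nhds_zero {δ δ' : ℝ} (hδ' : 0 < δ') (hle : δ' ≤ δ) : (Icc 0 δ' : Set ℝ) =ᶠ[𝓝 (0 : ℝ)] (Icc 0 δ : Set ℝ) := by
  filter_upwards [Iio_mem_nhds hδ'] with x (hx : x < δ')
  simp only [eq_iff_iff]
  constructor
  · exact fun h => ⟨h.1, h.2.trans hle⟩
  · exact fun h => ⟨h.1, hx.le⟩

/-- One-sided jets at `0` within nested intervals `[0, δ′] ⊆ [0, δ]` agree. [folklore] -/
private theorem iteratedDerivWithin_Icc_zero_eq_of_le {f : ℝ → ℂ} {δ δ' : ℝ} (hδ' : 0 < δ') (hle : δ' ≤ δ) (n : ℕ) :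
    iteratedDerivWithin n f (Icc 0 δ') 0 = iteratedDerivWithin n f (Icc 0 δ) 0 := by
  rw [iteratedDerivWithin_eq_iteratedFDerivWithin, iteratedDerivWithin_eq_iteratedFDerivWithin,
    iteratedFDerivWithin_congr_set (Icc_eventuallyEq_Icc_nhds_zero hδ' hle) n]

/-! ## §2. The three transfer facts: compact support of the transported orbit function, the orbital identity, the centre -/

/-- Off the noncompact walls (`z₀ ≠ z₂`, `z₁ ≠ z₂`; same-sign pair `{0,1}`) the `G_w`-orbit function `g ↦ Θ(g·t(z)·g⁻¹)` of a test function with compact support on `G_w` has compact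
support (★ the orbit map is proper off the noncompact walls); transported through a frame `e(g) = T⁻¹gT` that is the identity on the torus, so does the `U(2,1)`-orbit function of
`Θ_T = Θ∘Ad(T)` at `mkU21 (diag z)`. [cite: Rogawski1990, §8.4 pp. 126–127] -/
theorem hasCompactSupport_comp_conjFrame_conj_mkU21 (hα : ∀ i, α i ≠ 0) (hreal : ∀ i, (w.1.embedding (α i)).im = 0)
    (hcpt : 0 < (w.1.embedding (α 0)).re * (w.1.embedding (α 1)).re)
    (T : GL (Fin 3) ℂ) (e : archLocal L 3 (Matrix.diagonal α) w ≃ₜ* U21)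
    (he : ∀ g : archLocal L 3 (Matrix.diagonal α) w, ((e g : U21) : GL (Fin 3) ℂ) = T⁻¹ * (g : GL (Fin 3) ℂ) * T)
    (hez : ∀ z : Fin 3 → Circle, ((e ⟨circleDiagonal 3 z, circleDiagonal_mem_archLocal_diagonal L 3 α w z⟩ : U21) : GL (Fin 3) ℂ) = circleDiagonal 3 z)
    (Θ : Matrix (Fin 3) (Fin 3) ℂ → ℂ) (hΘc : HasCompactSupport fun k : archLocal L 3 (Matrix.diagonal α) w => Θ ((k : GL (Fin 3) ℂ) : Matrix (Fin 3) (Fin 3) ℂ))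
    (z : Fin 3 → Circle) (hz02 : z 0 ≠ z 2) (hz12 : z 1 ≠ z 2) :
    HasCompactSupport fun u : U21 => Θ ((T : Matrix (Fin 3) (Fin 3) ℂ) *
      mat (u * mkU21 (Matrix.diagonal fun i => (z i : ℂ)) (diagonal_circle_preserves z) * u⁻¹) * ((T⁻¹ : GL (Fin 3) ℂ) : Matrix (Fin 3) (Fin 3) ℂ)) := by
  -- compact support on `G_w`: the blocks `{0,1} ∣ {2}`
  have hcG : HasCompactSupport fun g : archLocal L 3 (Matrix.diagonal α) w =>
      Θ (((g * ⟨circleDiagonal 3 z, circleDiagonal_mem_archLocal_diagonal L 3 α w z⟩ * g⁻¹ : archLocal L 3 (Matrix.diagonal α) w) : GL (Fin 3) ℂ) : Matrix (Fin 3) (Fin 3) ℂ) := by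
    refine hasCompactSupport_comp_conj_circleDiagonal_of_blocks L 3 α w hα hreal (![0, 0, 1] : Fin 3 → Fin 2) ?_ ?_
      (fun k : archLocal L 3 (Matrix.diagonal α) w => Θ ((k : GL (Fin 3) ℂ) : Matrix (Fin 3) (Fin 3) ℂ)) hΘc
    · intro i j hij hb
      fin_cases i <;> fin_cases j <;>
        first | exact absurd rfl hij | exact hcpt | (rw [mul_comm]; exact hcpt) | exact absurd hb (by decide)
    · intro i j hb
      fin_cases i <;> fin_cases j <;>
        first | exact absurd (by decide) hb | exact hz02 | exact hz12 | exact hz02.symm | exact hz12.symm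
  have htUe : e ⟨circleDiagonal 3 z, circleDiagonal_mem_archLocal_diagonal L 3 α w z⟩ = mkU21 (Matrix.diagonal fun i => (z i : ℂ)) (diagonal_circle_preserves z) := by
    apply Subtype.ext
    apply Units.ext
    rw [hez z]
    rfl
  have hfun : (fun u : U21 => Θ ((T : Matrix (Fin 3) (Fin 3) ℂ) *
      mat (u * mkU21 (Matrix.diagonal fun i => (z i : ℂ)) (diagonal_circle_preserves z) * u⁻¹) * ((T⁻¹ : GL (Fin 3) ℂ) : Matrix (Fin 3) (Fin 3) ℂ))) =
      (fun g : archLocal L 3 (Matrix.diagonal α) w =>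
        Θ (((g * ⟨circleDiagonal 3 z, circleDiagonal_mem_archLocal_diagonal L 3 α w z⟩ * g⁻¹ : archLocal L 3 (Matrix.diagonal α) w) : GL (Fin 3) ℂ) : Matrix (Fin 3) (Fin 3) ℂ)) ∘ e.symm := by
    funext u
    simp only [Function.comp_apply]
    congr 1
    obtain ⟨g, rfl⟩ : ∃ g, e g = u := ⟨e.symm u, e.apply_symm_apply u⟩
    rw [e.symm_apply_apply, ← htUe, ← map_inv, ← map_mul, ← map_mul,
      show mat (e (g * ⟨circleDiagonal 3 z, circleDiagonal_mem_archLocal_diagonal L 3 α w z⟩ * g⁻¹)) =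
        (((e (g * ⟨circleDiagonal 3 z, circleDiagonal_mem_archLocal_diagonal L 3 α w z⟩ * g⁻¹) : U21) : GL (Fin 3) ℂ) : Matrix (Fin 3) (Fin 3) ℂ) from rfl,
      he]
    simp only [← Units.val_mul]
    congr 1
    group
  rw [hfun]
  exact hcG.comp_homeomorph e.symm.toHomeomorph

/-- **The orbital identity** `m_K · Φ^{G_w}_Θ(z) = Φ^{U(2,1)}_{(Θ_T)^K}(z)` off the noncompact walls: ★ `integral_comp_conj_eq_integral_map_mkU21` (transport through the frame) followed by
★ `smul_integral_comp_conj_eq_integral_kAverage_comp_conj` (the `K`-average under the `U(2,1)`-integral). [cite: Rogawski1990, §8.4 pp. 126–127] -/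
theorem kMass_mul_orbital_eq_orbital_kAverage [MeasurableSpace (archLocal L 3 (Matrix.diagonal α) w)] [BorelSpace (archLocal L 3 (Matrix.diagonal α) w)]
    (hα : ∀ i, α i ≠ 0) (hreal : ∀ i, (w.1.embedding (α i)).im = 0) (hcpt : 0 < (w.1.embedding (α 0)).re * (w.1.embedding (α 1)).re)
    (T : GL (Fin 3) ℂ) (e : archLocal L 3 (Matrix.diagonal α) w ≃ₜ* U21)
    (he : ∀ g : archLocal L 3 (Matrix.diagonal α) w, ((e g : U21) : GL (Fin 3) ℂ) = T⁻¹ * (g : GL (Fin 3) ℂ) * T)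
    (hez : ∀ z : Fin 3 → Circle, ((e ⟨circleDiagonal 3 z, circleDiagonal_mem_archLocal_diagonal L 3 α w z⟩ : U21) : GL (Fin 3) ℂ) = circleDiagonal 3 z)
    (ν : Measure (archLocal L 3 (Matrix.diagonal α) w)) [ν.IsHaarMeasure]
    (Θ : Matrix (Fin 3) (Fin 3) ℂ → ℂ) (hΘ : Continuous Θ) (hΘc : HasCompactSupport fun k : archLocal L 3 (Matrix.diagonal α) w => Θ ((k : GL (Fin 3) ℂ) : Matrix (Fin 3) (Fin 3) ℂ))
    (z : Fin 3 → Circle) (hz02 : z 0 ≠ z 2) (hz12 : z 1 ≠ z 2) :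
    (((haar : Measure (stabilizer U21 x₀)).real univ : ℝ) : ℂ) * (∫ g, Θ (((g * ⟨circleDiagonal 3 z, circleDiagonal_mem_archLocal_diagonal L 3 α w z⟩ * g⁻¹ : archLocal L 3 (Matrix.diagonal α) w) : GL (Fin 3) ℂ) : Matrix (Fin 3) (Fin 3) ℂ) ∂ν) =
      ∫ u, (∫ k : stabilizer U21 x₀, Θ ((T : Matrix (Fin 3) (Fin 3) ℂ) * (mat (k : U21) *
        mat (u * mkU21 (Matrix.diagonal fun i => (z i : ℂ)) (diagonal_circle_preserves z) * u⁻¹) * mat ((k⁻¹ : stabilizer U21 x₀) : U21)) *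
        ((T⁻¹ : GL (Fin 3) ℂ) : Matrix (Fin 3) (Fin 3) ℂ)) ∂haar) ∂(ν.map e) := by
  haveI : (ν.map e).IsHaarMeasure := isHaarMeasure_map_archLocalEquiv L α w e ν
  rw [integral_comp_conj_eq_integral_map_mkU21 L α w T e he hez ν Θ z (diagonal_circle_preserves z), ← Complex.real_smul]
  have hcont : Continuous fun M : Matrix (Fin 3) (Fin 3) ℂ => Θ ((T : Matrix (Fin 3) (Fin 3) ℂ) * M * ((T⁻¹ : GL (Fin 3) ℂ) : Matrix (Fin 3) (Fin 3) ℂ)) :=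
    hΘ.comp ((continuous_const.mul continuous_id).mul continuous_const)
  exact smul_integral_comp_conj_eq_integral_kAverage_comp_conj (ν.map e)
    (fun M : Matrix (Fin 3) (Fin 3) ℂ => Θ ((T : Matrix (Fin 3) (Fin 3) ℂ) * M * ((T⁻¹ : GL (Fin 3) ℂ) : Matrix (Fin 3) (Fin 3) ℂ))) hcont
    (mkU21 (Matrix.diagonal fun i => (z i : ℂ)) (diagonal_circle_preserves z))
    (hasCompactSupport_comp_conjFrame_conj_mkU21 L α w hα hreal hcpt T e he hez Θ hΘc z hz02 hz12)

/-- **The centre**: the `K`-average of `Θ_T` at the scalar matrix `ζ•1` is `m_K · Θ(ζ•1)` (★ `kAverage_smul_one`; `T(ζ•1)T⁻¹ = ζ•1`). [cite: Rogawski1990, §8.4 pp. 126–127] -/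
theorem kAverage_comp_conjFrame_circleDiagonal_const (T : GL (Fin 3) ℂ) (Θ : Matrix (Fin 3) (Fin 3) ℂ → ℂ) (ζ : Circle) :
    (∫ k : stabilizer U21 x₀, Θ ((T : Matrix (Fin 3) (Fin 3) ℂ) * (mat (k : U21) * ((circleDiagonal 3 (fun _ => ζ) : GL (Fin 3) ℂ) : Matrix (Fin 3) (Fin 3) ℂ) *
        mat ((k⁻¹ : stabilizer U21 x₀) : U21)) * ((T⁻¹ : GL (Fin 3) ℂ) : Matrix (Fin 3) (Fin 3) ℂ)) ∂haar) =
      (((haar : Measure (stabilizer U21 x₀)).real univ : ℝ) : ℂ) * Θ ((circleDiagonal 3 (fun _ => ζ) : GL (Fin 3) ℂ) : Matrix (Fin 3) (Fin 3) ℂ) := by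
  have hcD : ((circleDiagonal 3 (fun _ => ζ) : GL (Fin 3) ℂ) : Matrix (Fin 3) (Fin 3) ℂ) = ((ζ : ℂ) • (1 : Matrix (Fin 3) (Fin 3) ℂ)) := by
    rw [coe_circleDiagonal, Matrix.smul_one_eq_diagonal]
  rw [hcD, kAverage_smul_one (fun M : Matrix (Fin 3) (Fin 3) ℂ => Θ ((T : Matrix (Fin 3) (Fin 3) ℂ) * M * ((T⁻¹ : GL (Fin 3) ℂ) : Matrix (Fin 3) (Fin 3) ℂ))) (ζ : ℂ),
    Complex.real_smul]
  simp only [Matrix.mul_smul, Matrix.smul_mul, Matrix.mul_one]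
  rw [← Units.val_mul, mul_inv_cancel, Units.val_one]

/-! ## §3. The transfer theorem -/

/-- **The D-chamber wall value on `G_w` from the ball-model value for `K`-invariant test functions** («hD ⟸ hD_K», Rogawski 1990 §8.4, Prop. 8.4.1(b); the Harish-Chandra limit
formula on the compact Cartan of `U(2,1)` for `K`-conjugation-invariant test functions, transported through a diagonal frame and the `K`-average).
At a place with `re σ_w(α₀), re σ_w(α₁) > 0 > re σ_w(α₂)`: `hBall` (see the module docstring) implies the `θ₂`-minimal D-chamber corner value `hDmin` of ★ FILE A′∕B, with the
SAME constant for all `Θ, ζ, σ, H`. [cite: Rogawski1990, §8.4 pp. 126–127; Prop. 8.4.1(b)] -/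
theorem cornerValue_min_of_ball (h0 : 0 < (w.1.embedding (α 0)).re) (h1 : 0 < (w.1.embedding (α 1)).re) (h2 : (w.1.embedding (α 2)).re < 0)
    (hBall : ∀ (μ : Measure BallModel.U21) [μ.IsHaarMeasure],
      ∃ c : ℝ, 0 < c ∧ ∀ (Θ' : Matrix (Fin 3) (Fin 3) ℂ → ℂ), ContDiff ℝ (⊤ : ℕ∞) Θ' →
        HasCompactSupport (fun u : BallModel.U21 => Θ' (BallModel.mat u)) →
        (∀ κ : Matrix (Fin 3) (Fin 3) ℂ, κ * κᴴ = 1 → κ * BallModel.J = BallModel.J * κ → ∀ X, Θ' (κ * X * κᴴ) = Θ' X) →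
        ∀ ζ : Circle, ∃ (δ : ℝ) (ψ χ : ℝ → ℂ), 0 < δ ∧ δ ≤ 2 ∧ ContDiffOn ℝ 2 ψ (Icc 0 δ) ∧ ContDiffOn ℝ 2 χ (Icc 0 δ) ∧
          (∀ t ∈ Ioo 0 δ, ψ t = ((2 - 2 * Real.cos (3 * t) : ℝ) : ℂ) *
            ∫ u, Θ' (BallModel.mat (u * BallModel.mkU21 (Matrix.diagonal fun i => (((fun j : Fin 3 => ζ * Circle.exp ((t • (![1, 1, -2] : Fin 3 → ℝ)) j)) i : Circle) : ℂ)) (BallModel.diagonal_circle_preserves (fun j : Fin 3 => ζ * Circle.exp ((t • (![1, 1, -2] : Fin 3 → ℝ)) j))) * u⁻¹)) ∂μ) ∧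
          (∀ t ∈ Ioo 0 δ, χ t = ((2 - 2 * Real.cos (3 * t) : ℝ) : ℂ) ^ 2 * iteratedDeriv 2 (fun s : ℝ =>
            ∫ u, Θ' (BallModel.mat (u * BallModel.mkU21 (Matrix.diagonal fun i => (((fun j : Fin 3 => (fun i : Fin 3 => ζ * Circle.exp ((t • (![1, 1, -2] : Fin 3 → ℝ)) i)) j * Circle.exp (s * (![1, -1, 0] : Fin 3 → ℝ) j)) i : Circle) : ℂ)) (BallModel.diagonal_circle_preserves (fun j : Fin 3 => (fun i : Fin 3 => ζ * Circle.exp ((t • (![1, 1, -2] : Fin 3 → ℝ)) i)) j * Circle.exp (s * (![1, -1, 0] : Fin 3 → ℝ) j))) * u⁻¹)) ∂μ) 0) ∧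
          -(2 / 3) * Complex.I * iteratedDerivWithin 2 ψ (Icc 0 δ) 0 - (1 / 2) * Complex.I * ψ 0 + (1 / 12) * Complex.I * iteratedDerivWithin 2 χ (Icc 0 δ) 0 =
            -((c : ℂ) * Complex.I) * Θ' ((circleDiagonal 3 (fun _ => ζ) : GL (Fin 3) ℂ) : Matrix (Fin 3) (Fin 3) ℂ)) :
    ∀ [MeasurableSpace (archLocal L 3 (Matrix.diagonal α) w)] [BorelSpace (archLocal L 3 (Matrix.diagonal α) w)],
      (∀ i, α i ≠ 0) → (∀ i, (w.1.embedding (α i)).im = 0) →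
      (∃ i j : Fin 3, (w.1.embedding (α i)).re * (w.1.embedding (α j)).re < 0) →
      ∀ (ν : Measure (archLocal L 3 (Matrix.diagonal α) w)) [ν.IsHaarMeasure] [ν.IsMulRightInvariant],
      ∃ c : ℝ, 0 < c ∧
        ∀ (Θ : Matrix (Fin 3) (Fin 3) ℂ → ℂ), ContDiff ℝ (⊤ : ℕ∞) Θ →
          HasCompactSupport (fun k : archLocal L 3 (Matrix.diagonal α) w => Θ ((k : GL (Fin 3) ℂ) : Matrix (Fin 3) (Fin 3) ℂ)) →
          ∀ (ζ : Circle) (σ : Equiv.Perm (Fin 3)), (σ 0 = 2) →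
            ∀ (U : Set (Fin 3 → ℝ)) (H : (Fin 3 → ℝ) → ℂ), IsOpen U → (0 : Fin 3 → ℝ) ∈ U → ContDiffOn ℝ 3 H U →
            (∀ θ ∈ U, θ (σ 0) < θ (σ 1) ∧ θ (σ 1) < θ (σ 2) →
              H θ = ((((ζ * Circle.exp (θ 0) : Circle) : ℂ)) * (((ζ * Circle.exp (θ 2) : Circle) : ℂ))⁻¹) * ((1 - (((ζ * Circle.exp (θ 1) : Circle) : ℂ)) * (((ζ * Circle.exp (θ 0) : Circle) : ℂ))⁻¹) * (1 - (((ζ * Circle.exp (θ 2) : Circle) : ℂ)) * (((ζ * Circle.exp (θ 1) : Circle) : ℂ))⁻¹) * (1 - (((ζ * Circle.exp (θ 2) : Circle) : ℂ)) * (((ζ * Circle.exp (θ 0) : Circle) : ℂ))⁻¹)) * (∫ g, Θ (((g * ⟨circleDiagonal 3 (fun k => ζ * Circle.exp (θ k)), circleDiagonal_mem_archLocal_diagonal L 3 α w _⟩ * g⁻¹ : archLocal L 3 (Matrix.diagonal α) w) : GL (Fin 3) ℂ) : Matrix (Fin 3) (Fin 3) ℂ) ∂ν)) →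
            (1 / 48 : ℂ) * ∑ ε : Fin 3 → Bool, ((((if ε 0 then (1 : ℝ) else -1) * (if ε 1 then (1 : ℝ) else -1) * (if ε 2 then (1 : ℝ) else -1) : ℝ)) : ℂ) *
          iteratedDeriv 3 (fun s : ℝ => H (s • ![(if ε 0 then (1 : ℝ) else -1) + (if ε 1 then (1 : ℝ) else -1), -(if ε 0 then (1 : ℝ) else -1) + (if ε 2 then (1 : ℝ) else -1), -(if ε 1 then (1 : ℝ) else -1) - (if ε 2 then (1 : ℝ) else -1)])) 0 =
                -((c : ℂ) * Complex.I) * Θ ((circleDiagonal 3 (fun _ => ζ) : GL (Fin 3) ℂ) : Matrix (Fin 3) (Fin 3) ℂ) := by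
  intro _ _ hα hreal _ ν _ _
  classical
  have hcpt : 0 < (w.1.embedding (α 0)).re * (w.1.embedding (α 1)).re := mul_pos h0 h1
  obtain ⟨T, e, -, he, hez⟩ := exists_continuousMulEquiv_archLocal_U21_torus L α w hreal h0 h1 h2
  haveI : (ν.map e).IsHaarMeasure := isHaarMeasure_map_archLocalEquiv L α w e ν
  obtain ⟨c, hc, hB⟩ := hBall (ν.map e)
  refine ⟨c, hc, fun Θ hΘ hΘc ζ σ hσ U H hU h0U hH hHF => ?_⟩
  -- (2)+(3) the transported, `K`-averaged test function `Θ′ = (Θ∘Ad T)^K` (kept opaque behind `hΘ'`)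
  obtain ⟨Θ', hΘ'⟩ : ∃ Θ' : Matrix (Fin 3) (Fin 3) ℂ → ℂ, Θ' = fun X => ∫ k : stabilizer U21 x₀,
      Θ ((T : Matrix (Fin 3) (Fin 3) ℂ) * (mat (k : U21) * X * mat ((k⁻¹ : stabilizer U21 x₀) : U21)) * ((T⁻¹ : GL (Fin 3) ℂ) : Matrix (Fin 3) (Fin 3) ℂ)) ∂haar := ⟨_, rfl⟩
  have hΘTd : ContDiff ℝ ∞ fun M : Matrix (Fin 3) (Fin 3) ℂ => Θ ((T : Matrix (Fin 3) (Fin 3) ℂ) * M * ((T⁻¹ : GL (Fin 3) ℂ) : Matrix (Fin 3) (Fin 3) ℂ)) :=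
    contDiff_comp_conjFrame T hΘ
  have hΘTc : HasCompactSupport fun u : U21 => Θ ((T : Matrix (Fin 3) (Fin 3) ℂ) * mat u * ((T⁻¹ : GL (Fin 3) ℂ) : Matrix (Fin 3) (Fin 3) ℂ)) :=
    hasCompactSupport_comp_conjFrame L α w T e he hΘc
  have hΘ'd : ContDiff ℝ (⊤ : ℕ∞) Θ' := by
    rw [hΘ']
    exact contDiff_kAverage (fun M : Matrix (Fin 3) (Fin 3) ℂ => Θ ((T : Matrix (Fin 3) (Fin 3) ℂ) * M * ((T⁻¹ : GL (Fin 3) ℂ) : Matrix (Fin 3) (Fin 3) ℂ))) hΘTd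
  have hΘ'c : HasCompactSupport fun u : U21 => Θ' (mat u) := by
    rw [hΘ']
    exact hasCompactSupport_kAverage_comp_mat (fun M : Matrix (Fin 3) (Fin 3) ℂ => Θ ((T : Matrix (Fin 3) (Fin 3) ℂ) * M * ((T⁻¹ : GL (Fin 3) ℂ) : Matrix (Fin 3) (Fin 3) ℂ))) hΘTc
  have hΘ'K : ∀ κ : Matrix (Fin 3) (Fin 3) ℂ, κ * κᴴ = 1 → κ * BallModel.J = BallModel.J * κ → ∀ X, Θ' (κ * X * κᴴ) = Θ' X := by
    intro κ hκ hκJ X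
    rw [hΘ']
    exact kAverage_conj_of_unitary_comm_J (fun M : Matrix (Fin 3) (Fin 3) ℂ => Θ ((T : Matrix (Fin 3) (Fin 3) ℂ) * M * ((T⁻¹ : GL (Fin 3) ℂ) : Matrix (Fin 3) (Fin 3) ℂ))) hκ hκJ X
  obtain ⟨δ, ψ, χ, hδ, hδ2, hψ, hχ, hψdef, hχdef, hval⟩ := hB Θ' hΘ'd hΘ'c hΘ'K ζ
  -- the mass `m_K > 0` of `K`, the centre, the orbital identity
  obtain ⟨m, hm⟩ : ∃ m : ℝ, m = (haar : Measure (stabilizer U21 x₀)).real univ := ⟨_, rfl⟩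
  have hm0 : 0 < m := by rw [hm]; exact measureReal_univ_pos
  have hmC : (m : ℂ) ≠ 0 := by exact_mod_cast hm0.ne'
  have hcen : Θ' ((circleDiagonal 3 (fun _ => ζ) : GL (Fin 3) ℂ) : Matrix (Fin 3) (Fin 3) ℂ) = (m : ℂ) * Θ ((circleDiagonal 3 (fun _ => ζ) : GL (Fin 3) ℂ) : Matrix (Fin 3) (Fin 3) ℂ) := by
    rw [hΘ', hm]
    exact kAverage_comp_conjFrame_circleDiagonal_const T Θ ζ
  -- the `G_w` torus orbital integral `Φ` (kept opaque behind `hΦ`, as ★ (A4)-I wants it)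
  obtain ⟨Φ, hΦ⟩ : ∃ Φ : (Fin 3 → Circle) → ℂ, Φ = fun z : Fin 3 → Circle => ∫ g, Θ (((g * ⟨circleDiagonal 3 z, circleDiagonal_mem_archLocal_diagonal L 3 α w z⟩ * g⁻¹ : archLocal L 3 (Matrix.diagonal α) w) : GL (Fin 3) ℂ) : Matrix (Fin 3) (Fin 3) ℂ) ∂ν := ⟨_, rfl⟩
  have horb : ∀ z : Fin 3 → Circle, z 0 ≠ z 2 → z 1 ≠ z 2 →
      (m : ℂ) * Φ z = ∫ u, Θ' (BallModel.mat (u * BallModel.mkU21 (Matrix.diagonal fun i => (((z) i : Circle) : ℂ)) (BallModel.diagonal_circle_preserves (z)) * u⁻¹)) ∂(ν.map e) := by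
    intro z hz02 hz12
    rw [hΦ, hΘ', hm]
    beta_reduce
    exact kMass_mul_orbital_eq_orbital_kAverage L α w hα hreal hcpt T e he hez ν Θ hΘ.continuous hΘc z hz02 hz12
  -- the corner extension `H` agrees with `ρ′Δ·Φ∘chart_ζ` on `U ∩ C_σ`
  have hHF' : ∀ θ ∈ U, θ ∈ {θ : Fin 3 → ℝ | θ (σ 0) < θ (σ 1) ∧ θ (σ 1) < θ (σ 2)} → H θ =
      ((((ζ * Circle.exp (θ 0) : Circle) : ℂ)) * (((ζ * Circle.exp (θ 2) : Circle) : ℂ))⁻¹) * ((1 - (((ζ * Circle.exp (θ 1) : Circle) : ℂ)) * (((ζ * Circle.exp (θ 0) : Circle) : ℂ))⁻¹) * (1 - (((ζ * Circle.exp (θ 2) : Circle) : ℂ)) * (((ζ * Circle.exp (θ 1) : Circle) : ℂ))⁻¹) * (1 - (((ζ * Circle.exp (θ 2) : Circle) : ℂ)) * (((ζ * Circle.exp (θ 0) : Circle) : ℂ))⁻¹)) * Φ (fun j : Fin 3 => ζ * Circle.exp (θ j)) := by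
    intro θ hθ hC
    rw [hHF θ hθ hC, hΦ]
  -- the `θ₂`-minimal chamber and the wall inside `U`
  have hCo : IsOpen {θ : Fin 3 → ℝ | θ (σ 0) < θ (σ 1) ∧ θ (σ 1) < θ (σ 2)} := isOpen_chamber σ
  have hwallC : ∀ t : ℝ, 0 < t → t • (![1, 1, -2] : Fin 3 → ℝ) ∈ closure {θ : Fin 3 → ℝ | θ (σ 0) < θ (σ 1) ∧ θ (σ 1) < θ (σ 2)} := by
    intro t ht
    rcases perm_fin_three_of_apply_zero_eq_two σ hσ with ⟨h1', h2'⟩ | ⟨h1', h2'⟩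
    · simp only [hσ, h1', h2']
      exact (wallPoint_mem_closure_chamber_pos ht).1
    · simp only [hσ, h1', h2']
      exact (wallPoint_mem_closure_chamber_pos ht).2
  have hev : ∀ᶠ t : ℝ in 𝓝 0, t • (![1, 1, -2] : Fin 3 → ℝ) ∈ U := by
    have hc : Continuous fun t : ℝ => t • (![1, 1, -2] : Fin 3 → ℝ) := continuous_id.smul continuous_const
    exact hc.continuousAt.preimage_mem_nhds (by rw [zero_smul]; exact hU.mem_nhds h0U)
  obtain ⟨ε, hε, hεU⟩ := Metric.eventually_nhds_iff.mp hev
  obtain ⟨δ', hδ'⟩ : ∃ δ' : ℝ, δ' = min δ ε := ⟨_, rfl⟩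
  have hδ'0 : 0 < δ' := hδ' ▸ lt_min hδ hε
  have hδ'δ : δ' ≤ δ := hδ' ▸ min_le_left _ _
  have hδ'2 : δ' ≤ 2 := hδ'δ.trans hδ2
  have hwall : ∀ t ∈ Ioo 0 δ', t • (![1, 1, -2] : Fin 3 → ℝ) ∈ U ∧
      t • (![1, 1, -2] : Fin 3 → ℝ) ∈ closure {θ : Fin 3 → ℝ | θ (σ 0) < θ (σ 1) ∧ θ (σ 1) < θ (σ 2)} := by
    intro t ht
    refine ⟨hεU ?_, hwallC t ht.1⟩
    rw [dist_zero_right, Real.norm_eq_abs, abs_of_pos ht.1]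
    exact ht.2.trans_le (hδ' ▸ min_le_right _ _)
  -- (4) the germs `ψ₁ = m_K⁻¹ψ`, `χ₁ = m_K⁻¹χ` (opaque behind `hψ₁e`, `hχ₁e`) are (A4)-I wall germs for `Φ`
  obtain ⟨ψ₁, hψ₁e⟩ : ∃ ψ₁ : ℝ → ℂ, ψ₁ = fun t : ℝ => (m : ℂ)⁻¹ * ψ t := ⟨_, rfl⟩
  obtain ⟨χ₁, hχ₁e⟩ : ∃ χ₁ : ℝ → ℂ, χ₁ = fun t : ℝ => (m : ℂ)⁻¹ * χ t := ⟨_, rfl⟩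
  have hψ₁ : ContDiffOn ℝ 2 ψ₁ (Icc 0 δ') := hψ₁e ▸ (contDiffOn_const.mul hψ).mono (Icc_subset_Icc le_rfl hδ'δ)
  have hχ₁ : ContDiffOn ℝ 2 χ₁ (Icc 0 δ') := hχ₁e ▸ (contDiffOn_const.mul hχ).mono (Icc_subset_Icc le_rfl hδ'δ)
  have hψdef₁ : ∀ t ∈ Ioo 0 δ', ψ₁ t = ((2 - 2 * Real.cos (3 * t) : ℝ) : ℂ) * Φ (fun j : Fin 3 => ζ * Circle.exp ((t • (![1, 1, -2] : Fin 3 → ℝ)) j)) := by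
    intro t ht
    have htδ : t ∈ Ioo 0 δ := ⟨ht.1, ht.2.trans_le hδ'δ⟩
    have hoff := wallPoint_off_noncompact_walls ζ ht.1.ne' (by rw [abs_of_pos ht.1]; exact (ht.2.trans_le hδ'2).le)
    rw [hψ₁e]
    beta_reduce
    rw [hψdef t htδ, ← horb _ hoff.1 hoff.2, mul_left_comm, inv_mul_cancel_left₀ hmC]
  have hχdef₁ : ∀ t ∈ Ioo 0 δ', χ₁ t = ((2 - 2 * Real.cos (3 * t) : ℝ) : ℂ) ^ 2 *
      iteratedDeriv 2 (fun s : ℝ => Φ (fun j : Fin 3 => (fun i : Fin 3 => ζ * Circle.exp ((t • (![1, 1, -2] : Fin 3 → ℝ)) i)) j * Circle.exp (s * (![1, -1, 0] : Fin 3 → ℝ) j))) 0 := by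
    intro t ht
    have htδ : t ∈ Ioo 0 δ := ⟨ht.1, ht.2.trans_le hδ'δ⟩
    have ht2 : t ≤ 2 := (ht.2.trans_le hδ'2).le
    -- near `s = 0` the normal ray is off the noncompact walls, so the orbital identity holds there
    have hr : 0 < min (3 * t / 2) (1 / 4) := lt_min (by linarith [ht.1]) (by norm_num)
    have hnear : ∀ᶠ s : ℝ in 𝓝 0, |s| < min (3 * t / 2) (1 / 4) := by
      filter_upwards [Ioo_mem_nhds (neg_lt_zero.mpr hr) hr] with s hs using abs_lt.mpr hs
    have hEq : (fun s : ℝ => ∫ u, Θ' (BallModel.mat (u * BallModel.mkU21 (Matrix.diagonal fun i => (((fun j : Fin 3 => (fun i : Fin 3 => ζ * Circle.exp ((t • (![1, 1, -2] : Fin 3 → ℝ)) i)) j * Circle.exp (s * (![1, -1, 0] : Fin 3 → ℝ) j)) i : Circle) : ℂ)) (BallModel.diagonal_circle_preserves (fun j : Fin 3 => (fun i : Fin 3 => ζ * Circle.exp ((t • (![1, 1, -2] : Fin 3 → ℝ)) i)) j * Circle.exp (s * (![1, -1, 0] : Fin 3 → ℝ) j))) * u⁻¹)) ∂(ν.map e))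 =ᶠ[𝓝 0]
        (fun s : ℝ => (m : ℂ) * Φ (fun j : Fin 3 => (fun i : Fin 3 => ζ * Circle.exp ((t • (![1, 1, -2] : Fin 3 → ℝ)) i)) j * Circle.exp (s * (![1, -1, 0] : Fin 3 → ℝ) j))) := by
      filter_upwards [hnear] with s hs
      have hoff := normalRay_off_noncompact_walls ζ ht.1 ht2 hs
      rw [horb _ hoff.1 hoff.2]
    rw [hχ₁e]
    beta_reduce
    rw [hχdef t htδ, hEq.iteratedDeriv_eq 2, iteratedDeriv_const_mul_field, mul_left_comm, inv_mul_cancel_left₀ hmC]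
  -- (A4)-I on `G_w`
  haveI : IsFiniteMeasureOnCompacts ν := inferInstance
  have hA4 := lambda8Angle_cornerExtension_eq_of_orbital_compactWallGerms L α w hα hreal hcpt ν Θ hΘ hΘc ζ Φ hΦ
    (C := {θ : Fin 3 → ℝ | θ (σ 0) < θ (σ 1) ∧ θ (σ 1) < θ (σ 2)}) (U := U) hCo hU h0U (H := H) hH hHF'
    (δ := δ') hδ'0 hδ'2 hwall (ψ := ψ₁) (χ := χ₁) hψ₁ hχ₁ hψdef₁ hχdef₁
  rw [hA4.1, hψ₁e, hχ₁e, iteratedDerivWithin_const_mul_field, iteratedDerivWithin_const_mul_field,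
    iteratedDerivWithin_Icc_zero_eq_of_le hδ'0 hδ'δ, iteratedDerivWithin_Icc_zero_eq_of_le hδ'0 hδ'δ]
  rw [hcen] at hval
  beta_reduce
  calc -(2 / 3) * Complex.I * ((m : ℂ)⁻¹ * iteratedDerivWithin 2 ψ (Icc 0 δ) 0) - (1 / 2) * Complex.I * ((m : ℂ)⁻¹ * ψ 0) +
        (1 / 12) * Complex.I * ((m : ℂ)⁻¹ * iteratedDerivWithin 2 χ (Icc 0 δ) 0)
      = (m : ℂ)⁻¹ * (-(2 / 3) * Complex.I * iteratedDerivWithin 2 ψ (Icc 0 δ) 0 - (1 / 2) * Complex.I * ψ 0 + (1 / 12) * Complex.I * iteratedDerivWithin 2 χ (Icc 0 δ) 0) := by ring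
    _ = (m : ℂ)⁻¹ * (-((c : ℂ) * Complex.I) * ((m : ℂ) * Θ ((circleDiagonal 3 (fun _ => ζ) : GL (Fin 3) ℂ) : Matrix (Fin 3) (Fin 3) ℂ))) := by rw [hval]
    _ = -((c : ℂ) * Complex.I) * Θ ((circleDiagonal 3 (fun _ => ζ) : GL (Fin 3) ℂ) : Matrix (Fin 3) (Fin 3) ℂ) := by
      field_simp

end

end Literature.NumberTheory.Rogawski1990
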